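import Summits.NavierStokesRegularity.NavierStokesRegularity.Theorems.TypeIQuarterGateQuarterLawCountsScars
import HarnessLib

/-!
# `TypeIQuarterGate`: the crux `FiniteScarsTypeI` (stmt-23842) follows from the crux `QuarterLawTypeI`
# (stmt-23726) — K1 ⇒ S1 by the landed item `QuarterLawCountsScars` (stmt-23912)

Helper file (`--supports stmt-NavierStokesRegularity-23842`). The route text: "Hence K1 `QuarterLawTypeI` ⇒
the conclusion of `FiniteScarsTypeI` (stmt-23842): the open rung 'finite singular set under the sup-norm
Type-I rate' is reached from K1 by provable glue." The glue is the landed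
`typeIQuarterGate_quarterLawCountsScars_proof`; this file records the implication between the two cruxes.
HONEST FRAMING: an implication between OPEN statements; neither is asserted; nothing about Navier–Stokes
regularity is claimed. [folklore]
-/

-- the problem directory repeats the summit name (`NavierStokesRegularity/NavierStokesRegularity`)
set_option linter.dupNamespace false

namespace Summit.NavierStokesRegularity.NavierStokesRegularity.Theorems

/-- **K1 ⇒ S1**: `QuarterLawTypeI → FiniteScarsTypeI` (cruxes 23726 ⇒ 23842 of route `TypeIQuarterGate`),
via the landed `QuarterLawCountsScars` (23912). Implication between open statements. [folklore] -/
theorem finiteScarsTypeI_of_quarterLawTypeI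
    (hK : Summit.NavierStokesRegularity.NavierStokesRegularity.Theses.TypeIQuarterGate.QuarterLawTypeI) :
    Summit.NavierStokesRegularity.NavierStokesRegularity.Theses.TypeIQuarterGate.FiniteScarsTypeI := by
  unfold Summit.NavierStokesRegularity.NavierStokesRegularity.Theses.TypeIQuarterGate.FiniteScarsTypeI
  intro ν T hν hT u p hmax hLH hdec hI
  obtain ⟨K, hq⟩ := hK ν T hν hT u p hmax hLH hdec hI
  have h := typeIQuarterGate_quarterLawCountsScars_proof
  unfold Summit.NavierStokesRegularity.NavierStokesRegularity.Theses.TypeIQuarterGate.QuarterLawCountsScars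
    at h
  exact h ν T hν hT u p hmax.1 hLH hdec K hq

end Summit.NavierStokesRegularity.NavierStokesRegularity.Theorems
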